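import Literature.Computability.AlgebraicComplexity.SmallFormatRankSetup
import Mathlib.Tactic.IntervalCases
import HarnessLib

/-!
# Bläser 2003, Lemma 5 for `⟨3,3,3⟩`: the two instances used in §4, and flag bookkeeping

Topic `Literature/Computability/AlgebraicComplexity`. Source: M. Bläser, *On the complexity of
the multiplication of matrices of small formats*, J. Complexity 19 (2003) 43–60 [Blaser2003],
Lemma 5 (p. 48) with Lemma 3, specialised to `c = m = n = 3` and to the two instances used in
§4 (pp. 52–53): with `W = W₁ + W₂`,
* (A) `t = 3`: `W₁ ⊆ Z₁`, `W₁ ∩ L₁ = 0`, `W₂ ⊆ Z₂`, `W₂ ∩ L₂ = 0` (`W₃ = 0`);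
* (B) `t = 2`: `W₁ ⊆ Z₁`, `W₁ ∩ L₁ = 0`, `W₂ ⊆ L₂`, `dim W₂ ≤ 2`;
in both cases, if four distinct `w_ρ` of a computation for `⟨3,3,3⟩` lie in `W`, then its length
is `≥ 3·3 + 3·2 + 4 = 19` (`lemma5A_card`, `lemma5B_card`). Both are COROLLARIES of the general
`blaser2003_lemma5_card` of `SmallFormatRankFlag.lean` (Lemma 5 + Lemma 3 for `⟨c,m,n⟩`), applied
to the bundled computation `IsComp.toBilinComp`.
Also here: the dimensions `dim L₁ = 6`, `dim L₂ = 3`, `dim R = 6`, `dim Srow = 3`, the inclusions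
among the flag subspaces, and that `L₂`, `R` are left/right ideals. All PROVED.
-/

namespace Literature.Computability.AlgebraicComplexity

namespace Blaser2003

open Matrix Module

variable {K : Type*} [Field K]

/-! ## Dimensions and inclusions of the flag -/

/-- `dim L₁ = 6`. [cite: Blaser2003, §4] -/
theorem finrank_L1 : finrank K (L1 : Submodule K (Mat3 K)) = 6 := by
  have hker : (L1 : Submodule K (Mat3 K)) = LinearMap.ker col0 := by
    ext x; simp [col0, funext_iff]
  rw [hker]
  have hsurj : LinearMap.range (col0 : Mat3 K →ₗ[K] (Fin 3 → K)) = ⊤ := by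
    rw [LinearMap.range_eq_top]
    intro y
    exact ⟨Matrix.of fun i j => if j = 0 then y i else 0, by ext i; simp [col0]⟩
  have h := LinearMap.finrank_range_add_finrank_ker (col0 : Mat3 K →ₗ[K] (Fin 3 → K))
  rw [hsurj, finrank_top, finrank_Mat3, Module.finrank_fintype_fun_eq_card,
    Fintype.card_fin] at h
  omega

/-- `dim L₂ = 3`. [cite: Blaser2003, §4] -/
theorem finrank_L2 : finrank K (L2 : Submodule K (Mat3 K)) = 3 := by
  have hker : (L2 : Submodule K (Mat3 K)) = LinearMap.ker cols01 := by
    ext x; simp [cols01, funext_iff, Prod.ext_iff, forall_and]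
  rw [hker]
  have hsurj : LinearMap.range (cols01 : Mat3 K →ₗ[K] (Fin 3 → K) × (Fin 3 → K)) = ⊤ := by
    rw [LinearMap.range_eq_top]
    rintro ⟨y, z⟩
    refine ⟨Matrix.of fun i j => if j = 0 then y i else if j = 1 then z i else 0, ?_⟩
    ext i <;> simp [cols01]
  have h := LinearMap.finrank_range_add_finrank_ker
    (cols01 : Mat3 K →ₗ[K] (Fin 3 → K) × (Fin 3 → K))
  rw [hsurj, finrank_top, finrank_Mat3, Module.finrank_prod,
    Module.finrank_fintype_fun_eq_card, Fintype.card_fin] at h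
  omega

/-- `dim R = 6`. [cite: Blaser2003, §4] -/
theorem finrank_R0 : finrank K (R0 : Submodule K (Mat3 K)) = 6 := by
  have hker : (R0 : Submodule K (Mat3 K)) = LinearMap.ker row0 := by
    ext x; simp [row0, funext_iff]
  rw [hker]
  have hsurj : LinearMap.range (row0 : Mat3 K →ₗ[K] (Fin 3 → K)) = ⊤ := by
    rw [LinearMap.range_eq_top]
    intro y
    exact ⟨Matrix.of fun i j => if i = 0 then y j else 0, by ext j; simp [row0]⟩
  have h := LinearMap.finrank_range_add_finrank_ker (row0 : Mat3 K →ₗ[K] (Fin 3 → K))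
  rw [hsurj, finrank_top, finrank_Mat3, Module.finrank_fintype_fun_eq_card,
    Fintype.card_fin] at h
  omega

/-- `dim Srow = 3`. [cite: Blaser2003, §4] -/
theorem finrank_Srow : finrank K (Srow : Submodule K (Mat3 K)) = 3 := by
  have hsurj : LinearMap.range (rows01 : Mat3 K →ₗ[K] (Fin 3 → K) × (Fin 3 → K)) = ⊤ := by
    rw [LinearMap.range_eq_top]
    rintro ⟨y, z⟩
    refine ⟨Matrix.of fun i j => if i = 0 then y j else if i = 1 then z j else 0, ?_⟩
    ext j <;> simp [rows01]
  have h := LinearMap.finrank_range_add_finrank_ker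
    (rows01 : Mat3 K →ₗ[K] (Fin 3 → K) × (Fin 3 → K))
  rw [hsurj, finrank_top, finrank_Mat3, Module.finrank_prod,
    Module.finrank_fintype_fun_eq_card, Fintype.card_fin] at h
  change 3 + 3 + finrank K (Srow : Submodule K (Mat3 K)) = 9 at h
  omega

/-- `L₂ ⊆ L₁`. [cite: Blaser2003, §4] -/
theorem L2_le_L1 : (L2 : Submodule K (Mat3 K)) ≤ L1 := fun x hx => by
  rw [mem_L2] at hx; rw [mem_L1]; exact fun i => (hx i).1

/-- `L₁ ⊆ Z₁`. [cite: Blaser2003, §4] -/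
theorem L1_le_Z1 : (L1 : Submodule K (Mat3 K)) ≤ Z1 := fun x hx => by
  rw [mem_L1] at hx; rw [mem_Z1]; exact hx 0

/-- `Z₂ ⊆ L₁`. [cite: Blaser2003, §4] -/
theorem Z2_le_L1 : (Z2 : Submodule K (Mat3 K)) ≤ L1 := fun x hx => by
  rw [mem_Z2] at hx; rw [mem_L1]; exact hx.1

/-- `L₂ ⊆ Z₂`. [cite: Blaser2003, §4] -/
theorem L2_le_Z2 : (L2 : Submodule K (Mat3 K)) ≤ Z2 := fun x hx => by
  rw [mem_L2] at hx; rw [mem_Z2]; exact ⟨fun i => (hx i).1, (hx 0).2⟩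

/-- `R ⊆ Z₁`. [cite: Blaser2003, §4] -/
theorem R0_le_Z1 : (R0 : Submodule K (Mat3 K)) ≤ Z1 := fun x hx => by
  rw [mem_R0] at hx; rw [mem_Z1]; exact hx 0

/-- `R ⊆ Y`. [cite: Blaser2003, §4] -/
theorem R0_le_Y : (R0 : Submodule K (Mat3 K)) ≤ Y := fun x hx => by
  rw [mem_R0] at hx; rw [mem_Y]; exact ⟨hx 0, hx 1⟩

/-- `Y ⊆ Z₁`. [cite: Blaser2003, §4] -/
theorem Y_le_Z1 : (Y : Submodule K (Mat3 K)) ≤ Z1 := fun x hx => by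
  rw [mem_Y] at hx; rw [mem_Z1]; exact hx.1

/-! ## Small matrix facts -/

/-- Left multiplication preserves `L₂` (a left ideal). [cite: Blaser2003, §4] -/
theorem mul_mem_L2 (u : Mat3 K) {b : Mat3 K} (hb : b ∈ L2) : u * b ∈ L2 := by
  rw [mem_L2] at hb ⊢
  intro i
  simp [Matrix.mul_apply, (hb _).1, (hb _).2]

/-- Right multiplication preserves `R` (a right ideal). [cite: Blaser2003, §4] -/
theorem mul_mem_R0 {s : Mat3 K} (hs : s ∈ R0) (b : Mat3 K) : s * b ∈ R0 := by
  rw [mem_R0] at hs ⊢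
  intro j
  simp [Matrix.mul_apply, hs]

/-- A nonzero matrix has a nonzero entry. [folklore] -/
theorem exists_apply_ne_zero {a : Mat3 K} (ha : a ≠ 0) : ∃ l μ, a l μ ≠ 0 := by
  by_contra! h
  exact ha (Matrix.ext fun i j => by simpa using h i j)

/-! ## Lemma 5 with Lemma 3: the two instances -/

section Lemma5

variable {ι : Type*} [Fintype ι] {F G W : ι → Mat3 K}

/-- **Bläser 2003, Lemma 5 (with Lemma 3), instance `t = 3`, `c = m = n = 3`**: if `W₁ ⊆ Z₁`,
`W₁ ∩ L₁ = 0`, `W₂ ⊆ Z₂`, `W₂ ∩ L₂ = 0` and four distinct `w_ρ` of a computation for `⟨3,3,3⟩`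
lie in `W₁ + W₂`, then its length is `≥ 9 + 6 + 4 = 19` (Bläser 2003, p. 52, case `rk a = 2`:
"by Lemma 5 (with `t = 3`; set formally `W₃ = 0`) … by Lemma 3"). Corollary of
`blaser2003_lemma5_card`. [cite: Blaser2003, Lemma 5] -/
theorem lemma5A_card (h : IsComp F G W) {W₁ W₂ : Submodule K (Mat3 K)} (hW₁Z : W₁ ≤ Z1)
    (hW₁L : W₁ ⊓ L1 = ⊥) (hW₂Z : W₂ ≤ Z2) (hW₂L : W₂ ⊓ L2 = ⊥) (j : Fin 4 → ι)
    (hj : Function.Injective j) (hjW : ∀ k, W (j k) ∈ W₁ ⊔ W₂) : 19 ≤ Fintype.card ι := by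
  classical
  let Wf : ℕ → Submodule K (Mat3 K) := fun τ => if τ = 1 then W₁ else if τ = 2 then W₂ else ⊥
  have h1 : Wf 1 = W₁ := by simp [Wf]
  have h2 : Wf 2 = W₂ := by simp [Wf]
  have h3 : Wf 3 = ⊥ := by simp [Wf]
  have hZ : ∀ τ, 1 ≤ τ → τ < 3 → Wf τ ≤ zSub K 3 3 τ := by
    intro τ hτ1 hτ3
    interval_cases τ
    · rw [h1]; exact hW₁Z
    · rw [h2]; exact hW₂Z
  have hdisj : ∀ τ, 1 ≤ τ → τ < 3 → Disjoint (Wf τ) (colZero K 3 3 τ) := by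
    intro τ hτ1 hτ3
    interval_cases τ
    · rw [h1]; exact disjoint_iff.2 hW₁L
    · rw [h2]; exact disjoint_iff.2 hW₂L
  have hLt : Wf 3 ≤ colZero K 3 3 3 := by rw [h3]; exact bot_le
  have hdim : finrank K (Wf 3) < 3 := by rw [h3, finrank_bot]; norm_num
  have hsup : W₁ ⊔ W₂ ≤ ⨆ τ ∈ Finset.Icc 1 3, Wf τ := by
    refine sup_le ?_ ?_
    · have := le_biSup Wf (show (1 : ℕ) ∈ Finset.Icc 1 3 by simp)
      rwa [h1] at this
    · have := le_biSup Wf (show (2 : ℕ) ∈ Finset.Icc 1 3 by simp)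
      rwa [h2] at this
  have hN : ∀ i ∈ Finset.univ.image j, h.toBilinComp.w i ∈ ⨆ τ ∈ Finset.Icc 1 3, Wf τ := by
    intro i hi
    obtain ⟨k, -, rfl⟩ := Finset.mem_image.1 hi
    exact hsup (hjW k)
  have hcount := blaser2003_lemma5_card h.toBilinComp (by norm_num) (by norm_num) le_rfl Wf hZ
    hdisj hLt hdim (Finset.univ.image j) hN
  rw [Finset.card_image_of_injective _ hj, Finset.card_univ, Fintype.card_fin] at hcount
  omega

/-- **Bläser 2003, Lemma 5 (with Lemma 3), instance `t = 2`, `c = m = n = 3`**: if `W₁ ⊆ Z₁`,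
`W₁ ∩ L₁ = 0`, `W₂ ⊆ L₂`, `dim W₂ ≤ 2` and four distinct `w_ρ` of a computation for `⟨3,3,3⟩`
lie in `W₁ + W₂`, then its length is `≥ 19` (Bläser 2003, p. 53, case `rk a = 1`). Corollary of
`blaser2003_lemma5_card`. [cite: Blaser2003, Lemma 5] -/
theorem lemma5B_card (h : IsComp F G W) {W₁ W₂ : Submodule K (Mat3 K)} (hW₁Z : W₁ ≤ Z1)
    (hW₁L : W₁ ⊓ L1 = ⊥) (hW₂L : W₂ ≤ L2) (hW₂d : finrank K W₂ ≤ 2) (j : Fin 4 → ι)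
    (hj : Function.Injective j) (hjW : ∀ k, W (j k) ∈ W₁ ⊔ W₂) : 19 ≤ Fintype.card ι := by
  classical
  let Wf : ℕ → Submodule K (Mat3 K) := fun τ => if τ = 1 then W₁ else if τ = 2 then W₂ else ⊥
  have h1 : Wf 1 = W₁ := by simp [Wf]
  have h2 : Wf 2 = W₂ := by simp [Wf]
  have hZ : ∀ τ, 1 ≤ τ → τ < 2 → Wf τ ≤ zSub K 3 3 τ := by
    intro τ hτ1 hτ2
    interval_cases τ
    rw [h1]; exact hW₁Z
  have hdisj : ∀ τ, 1 ≤ τ → τ < 2 → Disjoint (Wf τ) (colZero K 3 3 τ) := by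
    intro τ hτ1 hτ2
    interval_cases τ
    rw [h1]; exact disjoint_iff.2 hW₁L
  have hLt : Wf 2 ≤ colZero K 3 3 2 := by rw [h2]; exact hW₂L
  have hdim : finrank K (Wf 2) < 3 := by rw [h2]; omega
  have hsup : W₁ ⊔ W₂ ≤ ⨆ τ ∈ Finset.Icc 1 2, Wf τ := by
    refine sup_le ?_ ?_
    · have := le_biSup Wf (show (1 : ℕ) ∈ Finset.Icc 1 2 by simp)
      rwa [h1] at this
    · have := le_biSup Wf (show (2 : ℕ) ∈ Finset.Icc 1 2 by simp)
      rwa [h2] at this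
  have hN : ∀ i ∈ Finset.univ.image j, h.toBilinComp.w i ∈ ⨆ τ ∈ Finset.Icc 1 2, Wf τ := by
    intro i hi
    obtain ⟨k, -, rfl⟩ := Finset.mem_image.1 hi
    exact hsup (hjW k)
  have hcount := blaser2003_lemma5_card h.toBilinComp (by norm_num) (by norm_num) (by norm_num)
    Wf hZ hdisj hLt hdim (Finset.univ.image j) hN
  rw [Finset.card_image_of_injective _ hj, Finset.card_univ, Fintype.card_fin] at hcount
  omega

end Lemma5

end Blaser2003

end Literature.Computability.AlgebraicComplexity
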